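import Summits.HodgeConjecture.HodgeConjecture.Cruxes.BlochSeedDiscOne.DepthBoundA4

/-!
# EighthCosetCarrier — an 8-cell subset of one rotation orbit kills every FULL-FREQUENCY (A1).1 word and carries `μ`
(plan-lens-HodgeAV-extremal g13, memo-13 §1–§2; node CIL law L3′ «Ω = μ-side full-frequency law, integer form»)

Token: line stmt-HodgeConjecture-18881 Cruxes/BlochSeedDiscOne/Lines/birth.lean 814a6a70c14e831a stub_rung_pad4_seedAt.

EVIDENCE-LEVEL TYPED FILE (kernel-checked finite facts about the rotation torus `(ℤ∕4)⁴`; NOT a rung; nothing here is proved toward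
HC ∕ HC_CM ∕ HC_AV ∕ №4 ∕ 26512 ∕ 18881 ∕ H2; letters ≠ sheaves ≠ a SEED; no bearing on `FloorFree 6 199 8` ∕ `Nonex 14 199 8` by itself).
Model of record: `DepthBoundA4.lean` (`Word`, `Sym.phase`, `Word.rotPhase`, `rotCell`, `cellCoef_rotCell_phase`).  Companion of
`HalfCosetGadget.lean` (extremal g8): there the 32-cell half-coset kills the WHOLE (A1).1 scope; here 8 cells kill exactly its
FULL-FREQUENCY part.

CONTENT.  Call a word FULL-FREQUENCY if every symbol is `e` or `ē` (the 16 words `{e,ē}⁴`; (A1).1 constrains the 14 of them other than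
`eeee`, `ēēēē`).  The EIGHTH SET `E₈ = {0000, 1300, 1030, 1003, 0130, 0103, 0013, 1111}` (8 rotation vectors: one representative of each
class `k mod K₈`, `K₈ = {k ∈ {0,2}⁴ : Σk ≡ 0 (4)}`, with `Σk ≡ 0 (4)` and `k mod 2` of even weight) satisfies: for EVERY full-frequency word
`w ≠ eeee, ēēēē` the character sum `Σ_{k ∈ E₈} ρ(w,k)` VANISHES, and on `eeee` it equals `8`.  By `cellCoef_rotCell_phase`: the 8-cell
design `{rotCell k x : k ∈ E₈}` (ANY base cell `x`, multiplicity 1 each) has `T(w) = 0` on all 14 constrained full-frequency words and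
`μ = 8 · cellCoef x eeee` — so if `x` is hub-free (`cellCoef x eeee ≠ 0`) it is a `μ`-carrier for the full-frequency rows with 8 cells in
8 distinct orientation classes.  CONTROL: `E₈` is NOT (A1).1-clean — low-frequency mixed words survive (witness `1 1 e ē ↦ 2`); the fully
clean single-orbit object remains the 32-cell half-coset.  Pencil context (memo-13 §1, Fourier inversion on `Q = (ℤ∕4)⁴ ∕ K₈`, |Q| = 32,
`Q̂ = {±1}⁴ ∪ {0,2}⁴`): a non-negative integer function on one free orbit whose transform vanishes on the 14 odd characters `≠ ±𝟙` is
`g(q) = E(q mod 2) + (1∕16) Re(A · i^{−Σq})` with `A = ĝ(𝟙) ∈ 8ℤ[i]` forced by integrality, so its mass is `≥ |Re A| + |Im A| ≥ 8`,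
with equality exactly on translates of `E₈`-type sets (exhaustive machine check ×1: no solution of mass ≤ 7, `omega13.py`).

THEOREMS (all kernel-checked, `decide +kernel` on closed finite statements): `eighthKs_length` (|E₈| = 8) · `eighthKs_sum` (E₈ ⊂ the
S₀-coset `Σk ≡ 0`) · `eighthKs_nodup` · `eighth_kills_fullfreq_pattern` (16 patterns) · `eighth_kills_fullfreq` (word form) · `eighth_eeee`
(Bloch sum = 8) · `eighth_not_clean_lowfreq` (control) · DESIGN LEVEL: `eighthDesignN_T`, `eighthDesignN_fullfreq_clean`, `eighthDesignN_mu`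
(`μ = 8 · cellCoef x eeee`), `eighthDesignN_copies` (= 8).

Kernel hygiene: imports `DepthBoundA4` only; 0 `sorry`; no `native_decide`; no axiom ∕ instance ∕ notation; no
`set_option allowUnsafeReducibility`.
-/

set_option linter.dupNamespace false
set_option autoImplicit false
set_option maxRecDepth 4096
set_option maxHeartbeats 4000000

namespace Summit.HodgeConjecture.HodgeConjecture.Cruxes.BlochSeedDiscOne.DepthBoundA4

section eighthcoset

/-- the EIGHTH SET `E₈` of rotation vectors (slots `0,1,2,3`). -/
def eighthKs : List (Fin 4 → Fin 4) :=
  [![0, 0, 0, 0], ![1, 3, 0, 0], ![1, 0, 3, 0], ![1, 0, 0, 3], ![0, 1, 3, 0], ![0, 1, 0, 3], ![0, 0, 1, 3], ![1, 1, 1, 1]]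

/-- character sum of a word over a list of rotation vectors: `Σ_k ρ(w,k)` (same functional as `HalfCosetGadget.charSum`, restated to keep
this file independent of that one). -/
def charSumE (w : Word) (L : List (Fin 4 → Fin 4)) : GaussianInt := (L.map fun k => w.rotPhase k).sum

/-- a FULL-FREQUENCY symbol: `e` or `ē`. -/
def Sym.isE : Sym → Bool
  | Sym.e => true
  | Sym.ebar => true
  | _ => false

theorem eighthKs_length : eighthKs.length = 8 := by decide +kernel

theorem eighthKs_nodup : eighthKs.Nodup := by decide +kernel

/-- `E₈` lies in the `S₀`-coset `Σ_f k_f ≡ 0 (mod 4)`. -/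
theorem eighthKs_sum : ∀ k ∈ eighthKs, ((k 0).val + (k 1).val + (k 2).val + (k 3).val) % 4 = 0 := by decide +kernel

/-- **THE CARRIER (pattern form, kernel).** For every full-frequency phase pattern other than `eeee`, `ēēēē`, the character sum over
`E₈` vanishes. -/
theorem eighth_kills_fullfreq_pattern :
    ∀ a b c d : Sym, Sym.isE a = true → Sym.isE b = true → Sym.isE c = true → Sym.isE d = true →
      (![a, b, c, d] : Word) ≠ Word.eeee → (![a, b, c, d] : Word) ≠ Word.EEEE →
      charSumE ![a, b, c, d] eighthKs = 0 := by
  decide +kernel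

theorem word_eq_vec' (w : Word) : w = ![w 0, w 1, w 2, w 3] := by
  funext f; fin_cases f <;> rfl

/-- **THE CARRIER.** `Σ_{k ∈ E₈} ρ(w,k) = 0` for every full-frequency word `w ≠ eeee, ēēēē`. -/
theorem eighth_kills_fullfreq (w : Word) (hE : ∀ f : Fin 4, Sym.isE (w f) = true) (h2 : w ≠ Word.eeee) (h3 : w ≠ Word.EEEE) :
    charSumE w eighthKs = 0 := by
  rw [word_eq_vec' w] at h2 h3 ⊢
  exact eighth_kills_fullfreq_pattern (w 0) (w 1) (w 2) (w 3) (hE 0) (hE 1) (hE 2) (hE 3) h2 h3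

/-- On the Bloch word the `E₈`-sum is `8` (so the piece carries `μ = 8 · cellCoef x eeee`). -/
theorem eighth_eeee : charSumE Word.eeee eighthKs = 8 := by decide +kernel

/-- … and on `ēēēē` it is `8` as well. -/
theorem eighth_EEEE : charSumE Word.EEEE eighthKs = 8 := by decide +kernel

/-- CONTROL: `E₈` is NOT (A1).1-clean — the low-frequency scope word `1 1 e ē` has character sum `2` on it. -/
theorem eighth_not_clean_lowfreq : charSumE ![Sym.one, Sym.one, Sym.e, Sym.ebar] eighthKs = 2 := by decide +kernel

/-! ### Design-level corollary: the 8-cell piece is full-frequency-clean on its own, with `μ = 8 · cellCoef x eeee` -/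

/-- the `E₈` piece on a base cell `x`: the cells `rotCell k x`, `k ∈ E₈`, multiplicity 1 each, on the N side. -/
def eighthDesignN (x : Cell) : Design :=
  ⟨eighthKs.map fun k => (rotCell k x, 1), []⟩

theorem eighthDesignN_T (x : Cell) (w : Word) :
    (eighthDesignN x).T w = charSumE w eighthKs * cellCoef x w := by
  unfold eighthDesignN Design.T charSumE
  simp only [List.map_map, List.map_nil, List.sum_nil, sub_zero]
  rw [← List.sum_map_mul_right]
  congr 1
  apply List.map_congr_left
  intro k _
  simp [Function.comp, cellCoef_rotCell_phase]

/-- the 14 constrained FULL-FREQUENCY rows of (A1).1 hold for the 8-cell piece alone, for EVERY base cell. -/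
theorem eighthDesignN_fullfreq_clean (x : Cell) :
    ∀ w : Word, (∀ f : Fin 4, Sym.isE (w f) = true) → w ≠ Word.eeee → w ≠ Word.EEEE → (eighthDesignN x).T w = 0 := by
  intro w h1 h2 h3
  rw [eighthDesignN_T, eighth_kills_fullfreq w h1 h2 h3, zero_mul]

/-- … its Bloch coefficient is `8 · ∏_f star β(x_f)` … -/
theorem eighthDesignN_mu (x : Cell) : (eighthDesignN x).mu = 8 * cellCoef x Word.eeee := by
  unfold Design.mu
  rw [eighthDesignN_T, eighth_eeee]

/-- … and it has 8 copies. -/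
theorem eighthDesignN_copies (x : Cell) : (eighthDesignN x).copies = 8 := by
  unfold eighthDesignN Design.copies
  simp [eighthKs]

/-- … but it is NOT (A1)-clean: on the base cell `b⁴ = ((2;2,2))⁴` the low-frequency word `1 1 e ē` has `T = 2 · 8 = 16 ≠ 0`
(so `E₈`-pieces are full-frequency carriers, not designs). -/
theorem eighthDesignN_not_A1_witness :
    (eighthDesignN (fun _ => (⟨2, 2, 2⟩ : Letter))).T ![Sym.one, Sym.one, Sym.e, Sym.ebar] ≠ 0 := by
  rw [eighthDesignN_T, eighth_not_clean_lowfreq]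
  decide +kernel

end eighthcoset

end Summit.HodgeConjecture.HodgeConjecture.Cruxes.BlochSeedDiscOne.DepthBoundA4
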